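import Summits.AtomisticToContinuum.HydrodynamicLimit.Theorems.StiffCollisionalRelaxationAprioriBoundsMesoCapstones
import Summits.AtomisticToContinuum.HydrodynamicLimit.Theorems.StiffCollisionalRelaxationAprioriBoundsMesoPairCorrelationGlue
import Summits.AtomisticToContinuum.HydrodynamicLimit.Theorems.StiffCollisionalRelaxationAprioriBoundsMesoPairDecorrelationDock
import HarnessLib

/-!
# Line `meso-chebyshev-window` (crux `AprioriBounds`, stmt-AtomisticToContinuum-14827): the capstones of skeleton r3
(lead prover-line-stmt-AtomisticToContinuum-14827-c10-0, cycle 3, 2026-08-17)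

Support file (`--supports stmt-AtomisticToContinuum-14827`).  Cycle 3 RESHAPED the two variance stubs of the line by the
exchangeability of the evolved local Gibbs law (`Var_{P_N}((N+1)⁻¹∑ᵢ gᵢ) = (N+1)⁻¹ Var g₀ + (N/(N+1)) Cov(g₀,g₁)`, landed in
`…MesoPairCorrelationGlue.lean` p167966 and `…MesoPairDecorrelationGlue.lean` p168171): r2-stub 3 `mesoVariance` ⟸ mean ceiling ∧
NEW stub 3 `pairCorrelation` (equal-time truncated pair correlation of two tagged spheres tested against `φ_N ⊗ φ_N`, Poisson order),
r2-stub 6 `occupationVariance` (= the D3 child `OccupationVariance`) ⟺ NEW stub 6 `pairDecorrelation` (covariance of two tagged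
spheres' time-averaged tail sojourns `→ 0`).  A dock hunt (wave 1, worker W3) found moreover that the variance child is implied by
FIXED-TIME ONE-BODY concentration of the tail fraction (Cauchy–Schwarz in time, `occupationVariance_of_fixedTimeTailVariance`
p168597), hence by the live one-body local-Maxwellian LLN `AnosovDiceHopf.MaxwellianOneBodyInBand` (stmt-17603;
`occupationVariance_of_maxwellianOneBodyInBand` p168989).  This file records the resulting IMPORTABLE compositions:

* `occupationVariance_of_pairDecorrelation`, `mesoVariance_of_meanCeiling_pairCorrelation` — the r3 → r2 glue under the crux prefix;
* `partTwo_of_meanBands_pairCorrelation` — component (ii) WITHOUT stmt-9201, r3 form;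
* `AprioriBounds_of_r3_stubs` (+ `PreShock`) — importable twin of the r3a skeleton theorem (five open stubs ⟹ crux by name);
* `AprioriBounds_of_KRC_GT_pairDecorrelation` — the D3 split with its one new child typed at BBGKY level two;
* `AprioriBounds_of_KRC_GT_fixedTimeTailVariance` — the D3 split with its one new child in one-body, fixed-time, identification-free
  form (the WEAKEST typed third child on the board);
* `AprioriBounds_of_KRC_GT_maxwellianOneBodyInBand` (+ `PreShock`) — THE CRUX FROM THREE EXISTING ITEMS 9201 ∧ 14415 ∧ 17603
  (strength caveat in the docstring: 17603 is local-equilibrium strength).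

Hierarchy of third children (each implication kernel-checked, all under the crux prefix, given 9201 ∧ 14415 for the rest):
`MaxwellianOneBodyInBand (17603)` ⟹ `FixedTimeTailVariance` ⟹ `OccupationVariance` ⟺ `PairDecorrelation` ⟹ (with `FarTailAllAt`)
`PartOneAt`.  No new definitions, no named facts, no sorry; axioms `propext`, `Classical.choice`, `Quot.sound`.
-/

noncomputable section

open MeasureTheory ProbabilityTheory Filter Set Topology
open scoped ENNReal

namespace Summit.AtomisticToContinuum.HydrodynamicLimit.Theorems.MesoChebyshevWindow

open Literature.MathematicalPhysics.KineticTheory Literature.Analysis.FluidPDE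
open Summit.AtomisticToContinuum.HydrodynamicLimit.Theorems.AprioriBoundsNegative (PartOneAt PartTwoAt)
open Summit.AtomisticToContinuum.HydrodynamicLimit.Theorems.VisitLedgerUpscattering (Cfg Flow Flows NiceProfiles)
open Summit.AtomisticToContinuum.HydrodynamicLimit.Theorems.FibreDeficitTransfer

/-- **r3-stub 6 ⟹ r2-stub 6 (importable form of the skeleton's `occupationVariance_of`).**  PAIR DECORRELATION of the time-averaged tail sojourns of two tagged spheres (registered stub `stub_pairDecorrelation`, r3 text verbatim, as hypothesis) implies the vanishing OCCUPATION VARIANCE (r2 stub 6 = the D3 child `OccupationVariance`, verbatim), by the landed exchangeability glue `stub_occupationVariance_of_pairDecorrelation` (p168171); `σ₀ := min σ₆ (1/2)`, `η₁ := η₆`.  (Converse: `pairDecorrelation_of_occupationVariance` in the glue file; the two statements are EQUIVALENT under the crux prefix.) -/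
theorem occupationVariance_of_pairDecorrelation : (∀ (a₀ θ₀ : T3 → ℝ) (u₀ : T3 → V3), Continuous a₀ → Continuous θ₀ → Continuous u₀ → (∀ x, 0 < a₀ x) → (∀ x, 0 < θ₀ x) → ∃ σ₀ : ℝ, 0 < σ₀ ∧ ∃ η₁ : ℝ, 0 < η₁ ∧ ∀ σ : ℝ, 0 < σ → σ < σ₀ → ∀ (T : ℝ) (ρ θ : ℝ → T3 → ℝ) (u : ℝ → T3 → V3), IsHardSphereEulerSolution σ T ρ u θ → ∀ Φ : (N : ℕ) → HardSphereFlow (Torus.geometry (Fin 3)) (hsDiameter σ N) (N + 1), TendstoHydroFieldsAt (fun N => localGibbsLaw σ a₀ u₀ θ₀ N (Φ N)) Φ ρ u θ 0 → ∀ t : ℝ, 0 < t → t < T → (∀ s ∈ Icc 0 t, ∀ x, 2 * ρ s x * σ ^ 3 < η₁) → ∀ K : ℝ, Tendsto (fun N : ℕ => (∫ z, (∫⁻ s in Icc 0 t, ENNReal.ofReal (if K ≤ ‖((Φ N).flow s z 0).2‖ ^ 2 then (1 : ℝ) else 0)).toReal * (∫⁻ s in Icc 0 t, ENNReal.ofReal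 (if K ≤ ‖((Φ N).flow s z 1).2‖ ^ 2 then (1 : ℝ) else 0)).toReal ∂(localGibbsLaw σ a₀ u₀ θ₀ N (Φ N))) - (∫ z, (∫⁻ s in Icc 0 t, ENNReal.ofReal (if K ≤ ‖((Φ N).flow s z 0).2‖ ^ 2 then (1 : ℝ) else 0)).toReal ∂(localGibbsLaw σ a₀ u₀ θ₀ N (Φ N))) * (∫ z, (∫⁻ s in Icc 0 t, ENNReal.ofReal (if K ≤ ‖((Φ N).flow s z 1).2‖ ^ 2 then (1 : ℝ) else 0)).toReal ∂(localGibbsLaw σ a₀ u₀ θ₀ N (Φ N)))) atTop (𝓝 0)) → ∀ (a₀ θ₀ : T3 → ℝ) (u₀ : T3 → V3), Continuous a₀ → Continuous θ₀ → Continuous u₀ → (∀ x, 0 < a₀ x) → (∀ x, 0 < θ₀ x) → ∃ σ₀ : ℝ, 0 < σ₀ ∧ ∃ η₁ : ℝ, 0 < η₁ ∧ ∀ σ : ℝ, 0 < σ → σ < σ₀ → ∀ (T : ℝ) (ρ θ : ℝ → T3 → ℝ) (u : ℝ → T3 → V3), IsHardSphereEulerSolution σ T ρ u θ → ∀ Φ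 : (N : ℕ) → HardSphereFlow (Torus.geometry (Fin 3)) (hsDiameter σ N) (N + 1), TendstoHydroFieldsAt (fun N => localGibbsLaw σ a₀ u₀ θ₀ N (Φ N)) Φ ρ u θ 0 → ∀ t : ℝ, 0 < t → t < T → (∀ s ∈ Icc 0 t, ∀ x, 2 * ρ s x * σ ^ 3 < η₁) → ∀ K : ℝ, Tendsto (fun N : ℕ => variance (fun z => (∫⁻ s in Icc 0 t, ENNReal.ofReal (frac K ((Φ N).flow s z))).toReal) (localGibbsLaw σ a₀ u₀ θ₀ N (Φ N))) atTop (𝓝 0) :=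
  by
  intro hD a₀ θ₀ u₀ ha hθ hu ha0 hθ0
  have hprof : NiceProfiles a₀ θ₀ u₀ := ⟨ha, hθ, hu, ha0, hθ0⟩
  obtain ⟨σ₆, hσ₆, η₆, hη₆, H6⟩ := hD a₀ θ₀ u₀ ha hθ hu ha0 hθ0
  refine ⟨min σ₆ (1 / 2), lt_min hσ₆ one_half_pos, η₆, hη₆, ?_⟩
  intro σ hσ hσlt T ρ θ u hsol Φ hLLN t ht htT hdil K
  simp only [lt_min_iff] at hσlt
  exact stub_occupationVariance_of_pairDecorrelation σ a₀ θ₀ u₀ Φ t hσ hσlt.2.le hprof ht K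
    (H6 σ hσ hσlt.1 T ρ θ u hsol Φ hLLN t ht htT hdil K)

/-- **stub 2 ∧ r3-stub 3 ⟹ r2-stub 3 (importable form of the skeleton's `mesoVariance_of`).**  The mean CEILING (registered stub `stub_meanCeiling`, verbatim) and the truncated PAIR CORRELATION bound of Poisson order (registered stub `stub_pairCorrelation`, r3 text verbatim) imply the POISSON-ORDER VARIANCE of the kernel block density (r2 stub 3 `stub_mesoVariance`, verbatim), by the landed exchangeability glue `stub_mesoVariance_of_pairCorrelation` (p167966) with `B := κ/σ³`; `σ₀ := min (min σ₂ σ₃) (1/2)`, `η₁ := min η₂ η₃`.  (Converse: `pairCorrelation_of_mesoVariance`, p167966.) -/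
theorem mesoVariance_of_meanCeiling_pairCorrelation : (∀ (a₀ θ₀ : T3 → ℝ) (u₀ : T3 → V3), Continuous a₀ → Continuous θ₀ → Continuous u₀ → (∀ x, 0 < a₀ x) → (∀ x, 0 < θ₀ x) → ∃ σ₀ : ℝ, 0 < σ₀ ∧ ∃ η₁ : ℝ, 0 < η₁ ∧ ∀ σ : ℝ, 0 < σ → σ < σ₀ → ∀ (T : ℝ) (ρ θ : ℝ → T3 → ℝ) (u : ℝ → T3 → V3), IsHardSphereEulerSolution σ T ρ u θ → ∀ Φ : (N : ℕ) → HardSphereFlow (Torus.geometry (Fin 3)) (hsDiameter σ N) (N + 1), TendstoHydroFieldsAt (fun N => localGibbsLaw σ a₀ u₀ θ₀ N (Φ N)) Φ ρ u θ 0 → ∀ t : ℝ, 0 < t → t < T → (∀ s ∈ Icc 0 t, ∀ x, 2 * ρ s x * σ ^ 3 < η₁) → ∀ (γ C : ℝ) (φ : ℕ → T3 → ℝ), 0 < γ → γ ≤ 1 / 15 → ((∀ N, Literature.Analysis.FunctionSpaces.Torus.IsSmooth (φ N)) ∧ (∀ N y, 0 ≤ φ N y) ∧ (∀ N, ∫ y,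 φ N y = 1) ∧ (∀ (N : ℕ) y, ((N : ℝ) + 1) ^ (-γ) ≤ Torus.euclidDist y 0 → φ N y = 0) ∧ (∀ (N : ℕ) y, φ N y ≤ C * ((N : ℝ) + 1) ^ (3 * γ)) ∧ (∀ (N : ℕ) y, ‖Literature.Analysis.FunctionSpaces.Torus.gradient (φ N) y‖ ≤ C * ((N : ℝ) + 1) ^ (4 * γ))) → ∃ κ : ℝ, κ < 1 ∧ ∃ N₀ : ℕ, ∀ N : ℕ, N₀ ≤ N → ∀ s ∈ Icc 0 t, ∀ x : T3, (∫ z, empiricalDensityField ((Φ N).flow s z) (fun y => φ N (y - x)) ∂(localGibbsLaw σ a₀ u₀ θ₀ N (Φ N))) * σ ^ 3 ≤ κ) → (∀ (a₀ θ₀ : T3 → ℝ) (u₀ : T3 → V3), Continuous a₀ → Continuous θ₀ → Continuous u₀ → (∀ x, 0 < a₀ x) → (∀ x, 0 < θ₀ x) → ∃ σ₀ : ℝ, 0 < σ₀ ∧ ∃ η₁ : ℝ, 0 < η₁ ∧ ∀ σ : ℝ, 0 < σ → σ < σ₀ → ∀ (T : ℝ) (ρ θ : ℝ → T3 → ℝ)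 (u : ℝ → T3 → V3), IsHardSphereEulerSolution σ T ρ u θ → ∀ Φ : (N : ℕ) → HardSphereFlow (Torus.geometry (Fin 3)) (hsDiameter σ N) (N + 1), TendstoHydroFieldsAt (fun N => localGibbsLaw σ a₀ u₀ θ₀ N (Φ N)) Φ ρ u θ 0 → ∀ t : ℝ, 0 < t → t < T → (∀ s ∈ Icc 0 t, ∀ x, 2 * ρ s x * σ ^ 3 < η₁) → ∀ (γ C : ℝ) (φ : ℕ → T3 → ℝ), 0 < γ → γ ≤ 1 / 15 → ((∀ N, Literature.Analysis.FunctionSpaces.Torus.IsSmooth (φ N)) ∧ (∀ N y, 0 ≤ φ N y) ∧ (∀ N, ∫ y, φ N y = 1) ∧ (∀ (N : ℕ) y, ((N : ℝ) + 1) ^ (-γ) ≤ Torus.euclidDist y 0 → φ N y = 0) ∧ (∀ (N : ℕ) y, φ N y ≤ C * ((N : ℝ) + 1) ^ (3 * γ)) ∧ (∀ (N : ℕ) y, ‖Literature.Analysis.FunctionSpaces.Torus.gradient (φ N) y‖ ≤ C * ((N : ℝ) + 1) ^ (4 * γ))) → ∃ A : ℝ, ∃ N₀ : ℕ, ∀ N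 : ℕ, N₀ ≤ N → ∀ s ∈ Icc 0 t, ∀ x : T3, (∫ z, φ N (((Φ N).flow s z 0).1 - x) * φ N (((Φ N).flow s z 1).1 - x) ∂(localGibbsLaw σ a₀ u₀ θ₀ N (Φ N))) - (∫ z, φ N (((Φ N).flow s z 0).1 - x) ∂(localGibbsLaw σ a₀ u₀ θ₀ N (Φ N))) * (∫ z, φ N (((Φ N).flow s z 1).1 - x) ∂(localGibbsLaw σ a₀ u₀ θ₀ N (Φ N))) ≤ A * ((N : ℝ) + 1) ^ (3 * γ - 1)) → ∀ (a₀ θ₀ : T3 → ℝ) (u₀ : T3 → V3), Continuous a₀ → Continuous θ₀ → Continuous u₀ → (∀ x, 0 < a₀ x) → (∀ x, 0 < θ₀ x) → ∃ σ₀ : ℝ, 0 < σ₀ ∧ ∃ η₁ : ℝ, 0 < η₁ ∧ ∀ σ : ℝ, 0 < σ → σ < σ₀ → ∀ (T : ℝ) (ρ θ : ℝ → T3 → ℝ) (u : ℝ → T3 → V3), IsHardSphereEulerSolution σ T ρ u θ → ∀ Φ : (N : ℕ) → HardSphereFlow (Torus.geometry (Fin 3)) (hsDiameter σ N) (N + 1),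 TendstoHydroFieldsAt (fun N => localGibbsLaw σ a₀ u₀ θ₀ N (Φ N)) Φ ρ u θ 0 → ∀ t : ℝ, 0 < t → t < T → (∀ s ∈ Icc 0 t, ∀ x, 2 * ρ s x * σ ^ 3 < η₁) → ∀ (γ C : ℝ) (φ : ℕ → T3 → ℝ), 0 < γ → γ ≤ 1 / 15 → ((∀ N, Literature.Analysis.FunctionSpaces.Torus.IsSmooth (φ N)) ∧ (∀ N y, 0 ≤ φ N y) ∧ (∀ N, ∫ y, φ N y = 1) ∧ (∀ (N : ℕ) y, ((N : ℝ) + 1) ^ (-γ) ≤ Torus.euclidDist y 0 → φ N y = 0) ∧ (∀ (N : ℕ) y, φ N y ≤ C * ((N : ℝ) + 1) ^ (3 * γ)) ∧ (∀ (N : ℕ) y, ‖Literature.Analysis.FunctionSpaces.Torus.gradient (φ N) y‖ ≤ C * ((N : ℝ) + 1) ^ (4 * γ))) → ∃ A : ℝ, ∃ N₀ : ℕ, ∀ N : ℕ, N₀ ≤ N → ∀ s ∈ Icc 0 t, ∀ x : T3, MemLp (fun z => empiricalDensityField ((Φ N).flow s z) (fun y => φ N (y - x))) 2 (localGibbsLaw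 σ a₀ u₀ θ₀ N (Φ N)) ∧ variance (fun z => empiricalDensityField ((Φ N).flow s z) (fun y => φ N (y - x))) (localGibbsLaw σ a₀ u₀ θ₀ N (Φ N)) ≤ A * ((N : ℝ) + 1) ^ (3 * γ - 1) :=
  by
  intro hC hP a₀ θ₀ u₀ ha hθ hu ha0 hθ0
  have hprof : NiceProfiles a₀ θ₀ u₀ := ⟨ha, hθ, hu, ha0, hθ0⟩
  obtain ⟨σ₂, hσ₂, η₂, hη₂, H2⟩ := hC a₀ θ₀ u₀ ha hθ hu ha0 hθ0
  obtain ⟨σ₃, hσ₃, η₃, hη₃, H3⟩ := hP a₀ θ₀ u₀ ha hθ hu ha0 hθ0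
  refine ⟨min (min σ₂ σ₃) (1 / 2), lt_min (lt_min hσ₂ hσ₃) one_half_pos, min η₂ η₃, lt_min hη₂ hη₃, ?_⟩
  intro σ hσ hσlt T ρ θ u hsol Φ hLLN t ht htT hdil γ C φ hγ hγ' hadm
  simp only [lt_min_iff] at hσlt hdil
  obtain ⟨⟨hs2, hs3⟩, hshalf⟩ := hσlt
  obtain ⟨κ, _hκ, N₂, hN₂⟩ :=
    H2 σ hσ hs2 T ρ θ u hsol Φ hLLN t ht htT (fun s hs x => (hdil s hs x).1) γ C φ hγ hγ' hadm
  have hPC := H3 σ hσ hs3 T ρ θ u hsol Φ hLLN t ht htT (fun s hs x => (hdil s hs x).2) γ C φ hγ hγ' hadm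
  have hσ3 : 0 < σ ^ 3 := pow_pos hσ 3
  have hB : ∃ B : ℝ, ∃ N₀ : ℕ, ∀ N : ℕ, N₀ ≤ N → ∀ s ∈ Icc 0 t, ∀ x : T3,
      ∫ z, empiricalDensityField ((Φ N).flow s z) (fun y => φ N (y - x))
        ∂(localGibbsLaw σ a₀ u₀ θ₀ N (Φ N)) ≤ B := by
    refine ⟨κ / σ ^ 3, N₂, fun N hN s hs x => ?_⟩
    rw [le_div_iff₀ hσ3]
    exact hN₂ N hN s hs x
  exact stub_mesoVariance_of_pairCorrelation σ a₀ θ₀ u₀ Φ t hσ hshalf.le hprof γ C φ hγ hadm hB hPC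

/-- **Component (ii) WITHOUT `KineticRangeControl` (stmt-9201), r3 form:** floor in the mean (stub 1) ∧ ceiling in the mean (stub 2) ∧ pair correlation of Poisson order (r3-stub 3) ⟹ component (ii) under the crux prefix (`PartTwoAt`), by `mesoVariance_of_meanCeiling_pairCorrelation` and the landed `partTwo_of_meanBands_mesoVariance` (p147849 ∘ p145137, the mesoscopic Chebyshev window). -/
theorem partTwo_of_meanBands_pairCorrelation : (∀ (a₀ θ₀ : T3 → ℝ) (u₀ : T3 → V3), Continuous a₀ → Continuous θ₀ → Continuous u₀ → (∀ x, 0 < a₀ x) → (∀ x, 0 < θ₀ x) → ∃ σ₀ : ℝ, 0 < σ₀ ∧ ∃ η₁ : ℝ, 0 < η₁ ∧ ∀ σ : ℝ, 0 < σ → σ < σ₀ → ∀ (T : ℝ) (ρ θ : ℝ → T3 → ℝ) (u : ℝ → T3 → V3), IsHardSphereEulerSolution σ T ρ u θ → ∀ Φ : (N : ℕ) → HardSphereFlow (Torus.geometry (Fin 3)) (hsDiameter σ N) (N + 1), TendstoHydroFieldsAt (fun N => localGibbsLaw σ a₀ u₀ θ₀ N (Φ N)) Φ ρ u θ 0 →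 ∀ t : ℝ, 0 < t → t < T → (∀ s ∈ Icc 0 t, ∀ x, 2 * ρ s x * σ ^ 3 < η₁) → ∀ (γ C : ℝ) (φ : ℕ → T3 → ℝ), 0 < γ → γ ≤ 1 / 15 → ((∀ N, Literature.Analysis.FunctionSpaces.Torus.IsSmooth (φ N)) ∧ (∀ N y, 0 ≤ φ N y) ∧ (∀ N, ∫ y, φ N y = 1) ∧ (∀ (N : ℕ) y, ((N : ℝ) + 1) ^ (-γ) ≤ Torus.euclidDist y 0 → φ N y = 0) ∧ (∀ (N : ℕ) y, φ N y ≤ C * ((N : ℝ) + 1) ^ (3 * γ)) ∧ (∀ (N : ℕ) y, ‖Literature.Analysis.FunctionSpaces.Torus.gradient (φ N) y‖ ≤ C * ((N : ℝ) + 1) ^ (4 * γ))) → ∃ m : ℝ, 0 < m ∧ ∃ N₀ : ℕ, ∀ N : ℕ, N₀ ≤ N → ∀ s ∈ Icc 0 t, ∀ x : T3, m ≤ ∫ z, empiricalDensityField ((Φ N).flow s z) (fun y => φ N (y - x)) ∂(localGibbsLaw σ a₀ u₀ θ₀ N (Φ N))) → (∀ (a₀ θ₀ : T3 → ℝ) (u₀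 : T3 → V3), Continuous a₀ → Continuous θ₀ → Continuous u₀ → (∀ x, 0 < a₀ x) → (∀ x, 0 < θ₀ x) → ∃ σ₀ : ℝ, 0 < σ₀ ∧ ∃ η₁ : ℝ, 0 < η₁ ∧ ∀ σ : ℝ, 0 < σ → σ < σ₀ → ∀ (T : ℝ) (ρ θ : ℝ → T3 → ℝ) (u : ℝ → T3 → V3), IsHardSphereEulerSolution σ T ρ u θ → ∀ Φ : (N : ℕ) → HardSphereFlow (Torus.geometry (Fin 3)) (hsDiameter σ N) (N + 1), TendstoHydroFieldsAt (fun N => localGibbsLaw σ a₀ u₀ θ₀ N (Φ N)) Φ ρ u θ 0 → ∀ t : ℝ, 0 < t → t < T → (∀ s ∈ Icc 0 t, ∀ x, 2 * ρ s x * σ ^ 3 < η₁) → ∀ (γ C : ℝ) (φ : ℕ → T3 → ℝ), 0 < γ → γ ≤ 1 / 15 → ((∀ N, Literature.Analysis.FunctionSpaces.Torus.IsSmooth (φ N)) ∧ (∀ N y, 0 ≤ φ N y) ∧ (∀ N, ∫ y, φ N y = 1) ∧ (∀ (N : ℕ) y, ((N : ℝ) + 1) ^ (-γ) ≤ Torus.euclidDist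 y 0 → φ N y = 0) ∧ (∀ (N : ℕ) y, φ N y ≤ C * ((N : ℝ) + 1) ^ (3 * γ)) ∧ (∀ (N : ℕ) y, ‖Literature.Analysis.FunctionSpaces.Torus.gradient (φ N) y‖ ≤ C * ((N : ℝ) + 1) ^ (4 * γ))) → ∃ κ : ℝ, κ < 1 ∧ ∃ N₀ : ℕ, ∀ N : ℕ, N₀ ≤ N → ∀ s ∈ Icc 0 t, ∀ x : T3, (∫ z, empiricalDensityField ((Φ N).flow s z) (fun y => φ N (y - x)) ∂(localGibbsLaw σ a₀ u₀ θ₀ N (Φ N))) * σ ^ 3 ≤ κ) → (∀ (a₀ θ₀ : T3 → ℝ) (u₀ : T3 → V3), Continuous a₀ → Continuous θ₀ → Continuous u₀ → (∀ x, 0 < a₀ x) → (∀ x, 0 < θ₀ x) → ∃ σ₀ : ℝ, 0 < σ₀ ∧ ∃ η₁ : ℝ, 0 < η₁ ∧ ∀ σ : ℝ, 0 < σ → σ < σ₀ → ∀ (T : ℝ) (ρ θ : ℝ → T3 → ℝ) (u : ℝ → T3 → V3), IsHardSphereEulerSolution σ T ρ u θ → ∀ Φ : (N : ℕ) → HardSphereFlow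 (Torus.geometry (Fin 3)) (hsDiameter σ N) (N + 1), TendstoHydroFieldsAt (fun N => localGibbsLaw σ a₀ u₀ θ₀ N (Φ N)) Φ ρ u θ 0 → ∀ t : ℝ, 0 < t → t < T → (∀ s ∈ Icc 0 t, ∀ x, 2 * ρ s x * σ ^ 3 < η₁) → ∀ (γ C : ℝ) (φ : ℕ → T3 → ℝ), 0 < γ → γ ≤ 1 / 15 → ((∀ N, Literature.Analysis.FunctionSpaces.Torus.IsSmooth (φ N)) ∧ (∀ N y, 0 ≤ φ N y) ∧ (∀ N, ∫ y, φ N y = 1) ∧ (∀ (N : ℕ) y, ((N : ℝ) + 1) ^ (-γ) ≤ Torus.euclidDist y 0 → φ N y = 0) ∧ (∀ (N : ℕ) y, φ N y ≤ C * ((N : ℝ) + 1) ^ (3 * γ)) ∧ (∀ (N : ℕ) y, ‖Literature.Analysis.FunctionSpaces.Torus.gradient (φ N) y‖ ≤ C * ((N : ℝ) + 1) ^ (4 * γ))) → ∃ A : ℝ, ∃ N₀ : ℕ, ∀ N : ℕ, N₀ ≤ N → ∀ s ∈ Icc 0 t, ∀ x : T3, (∫ z, φ N (((Φ N).flow s z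 0).1 - x) * φ N (((Φ N).flow s z 1).1 - x) ∂(localGibbsLaw σ a₀ u₀ θ₀ N (Φ N))) - (∫ z, φ N (((Φ N).flow s z 0).1 - x) ∂(localGibbsLaw σ a₀ u₀ θ₀ N (Φ N))) * (∫ z, φ N (((Φ N).flow s z 1).1 - x) ∂(localGibbsLaw σ a₀ u₀ θ₀ N (Φ N))) ≤ A * ((N : ℝ) + 1) ^ (3 * γ - 1)) → ∀ (a₀ θ₀ : T3 → ℝ) (u₀ : T3 → V3), Continuous a₀ → Continuous θ₀ → Continuous u₀ → (∀ x, 0 < a₀ x) → (∀ x, 0 < θ₀ x) → ∃ σ₀ : ℝ, 0 < σ₀ ∧ ∃ η₁ : ℝ, 0 < η₁ ∧ ∀ σ : ℝ, 0 < σ → σ < σ₀ → ∀ (T : ℝ) (ρ θ : ℝ → T3 → ℝ) (u : ℝ → T3 → V3), IsHardSphereEulerSolution σ T ρ u θ → ∀ Φ : (N : ℕ) → HardSphereFlow (Torus.geometry (Fin 3)) (hsDiameter σ N) (N + 1), TendstoHydroFieldsAt (fun N => localGibbsLaw σ a₀ u₀ θ₀ N (Φ N)) Φ ρ u θ 0 →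 ∀ t : ℝ, 0 < t → t < T → (∀ s ∈ Icc 0 t, ∀ x, 2 * ρ s x * σ ^ 3 < η₁) → PartTwoAt σ a₀ θ₀ u₀ Φ t :=
  fun hF hC hP =>
  partTwo_of_meanBands_mesoVariance hF hC (mesoVariance_of_meanCeiling_pairCorrelation hC hP)

/-- **Importable twin of the r3a skeleton theorem `AprioriBounds_of`** (`Cruxes/AprioriBounds/Lines/meso_chebyshev_window.lean`, lead c10, commit 1c641feac763): the five OPEN registered stubs of r3 — 1 `meanFloor`, 2 `meanCeiling`, 3 `pairCorrelation`, 5 `farTailAll`, 6 `pairDecorrelation`, each written out verbatim as a hypothesis — imply the crux decl `StiffCollisionalRelaxation.AprioriBounds` BY NAME (via `AprioriBounds_of_meso_stubs`, p147849, and the two r3 glue theorems above).  Any producer of a stub plugs in with one application. -/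
theorem AprioriBounds_of_r3_stubs : (∀ (a₀ θ₀ : T3 → ℝ) (u₀ : T3 → V3), Continuous a₀ → Continuous θ₀ → Continuous u₀ → (∀ x, 0 < a₀ x) → (∀ x, 0 < θ₀ x) → ∃ σ₀ : ℝ, 0 < σ₀ ∧ ∃ η₁ : ℝ, 0 < η₁ ∧ ∀ σ : ℝ, 0 < σ → σ < σ₀ → ∀ (T : ℝ) (ρ θ : ℝ → T3 → ℝ) (u : ℝ → T3 → V3), IsHardSphereEulerSolution σ T ρ u θ → ∀ Φ : (N : ℕ) → HardSphereFlow (Torus.geometry (Fin 3)) (hsDiameter σ N) (N + 1), TendstoHydroFieldsAt (fun N => localGibbsLaw σ a₀ u₀ θ₀ N (Φ N)) Φ ρ u θ 0 → ∀ t : ℝ, 0 < t → t < T → (∀ s ∈ Icc 0 t, ∀ x, 2 * ρ s x * σ ^ 3 < η₁) → ∀ (γ C : ℝ) (φ : ℕ → T3 → ℝ), 0 < γ → γ ≤ 1 / 15 → ((∀ N, Literature.Analysis.FunctionSpaces.Torus.IsSmooth (φ N)) ∧ (∀ N y, 0 ≤ φ N y) ∧ (∀ N, ∫ y, φ N y =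 1) ∧ (∀ (N : ℕ) y, ((N : ℝ) + 1) ^ (-γ) ≤ Torus.euclidDist y 0 → φ N y = 0) ∧ (∀ (N : ℕ) y, φ N y ≤ C * ((N : ℝ) + 1) ^ (3 * γ)) ∧ (∀ (N : ℕ) y, ‖Literature.Analysis.FunctionSpaces.Torus.gradient (φ N) y‖ ≤ C * ((N : ℝ) + 1) ^ (4 * γ))) → ∃ m : ℝ, 0 < m ∧ ∃ N₀ : ℕ, ∀ N : ℕ, N₀ ≤ N → ∀ s ∈ Icc 0 t, ∀ x : T3, m ≤ ∫ z, empiricalDensityField ((Φ N).flow s z) (fun y => φ N (y - x)) ∂(localGibbsLaw σ a₀ u₀ θ₀ N (Φ N))) → (∀ (a₀ θ₀ : T3 → ℝ) (u₀ : T3 → V3), Continuous a₀ → Continuous θ₀ → Continuous u₀ → (∀ x, 0 < a₀ x) → (∀ x, 0 < θ₀ x) → ∃ σ₀ : ℝ, 0 < σ₀ ∧ ∃ η₁ : ℝ, 0 < η₁ ∧ ∀ σ : ℝ, 0 < σ → σ < σ₀ → ∀ (T : ℝ) (ρ θ : ℝ → T3 → ℝ) (u : ℝ → T3 → V3), IsHardSphereEulerSolution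 σ T ρ u θ → ∀ Φ : (N : ℕ) → HardSphereFlow (Torus.geometry (Fin 3)) (hsDiameter σ N) (N + 1), TendstoHydroFieldsAt (fun N => localGibbsLaw σ a₀ u₀ θ₀ N (Φ N)) Φ ρ u θ 0 → ∀ t : ℝ, 0 < t → t < T → (∀ s ∈ Icc 0 t, ∀ x, 2 * ρ s x * σ ^ 3 < η₁) → ∀ (γ C : ℝ) (φ : ℕ → T3 → ℝ), 0 < γ → γ ≤ 1 / 15 → ((∀ N, Literature.Analysis.FunctionSpaces.Torus.IsSmooth (φ N)) ∧ (∀ N y, 0 ≤ φ N y) ∧ (∀ N, ∫ y, φ N y = 1) ∧ (∀ (N : ℕ) y, ((N : ℝ) + 1) ^ (-γ) ≤ Torus.euclidDist y 0 → φ N y = 0) ∧ (∀ (N : ℕ) y, φ N y ≤ C * ((N : ℝ) + 1) ^ (3 * γ)) ∧ (∀ (N : ℕ) y, ‖Literature.Analysis.FunctionSpaces.Torus.gradient (φ N) y‖ ≤ C * ((N : ℝ) + 1) ^ (4 * γ))) → ∃ κ : ℝ, κ < 1 ∧ ∃ N₀ : ℕ, ∀ N : ℕ, N₀ ≤ N →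 ∀ s ∈ Icc 0 t, ∀ x : T3, (∫ z, empiricalDensityField ((Φ N).flow s z) (fun y => φ N (y - x)) ∂(localGibbsLaw σ a₀ u₀ θ₀ N (Φ N))) * σ ^ 3 ≤ κ) → (∀ (a₀ θ₀ : T3 → ℝ) (u₀ : T3 → V3), Continuous a₀ → Continuous θ₀ → Continuous u₀ → (∀ x, 0 < a₀ x) → (∀ x, 0 < θ₀ x) → ∃ σ₀ : ℝ, 0 < σ₀ ∧ ∃ η₁ : ℝ, 0 < η₁ ∧ ∀ σ : ℝ, 0 < σ → σ < σ₀ → ∀ (T : ℝ) (ρ θ : ℝ → T3 → ℝ) (u : ℝ → T3 → V3), IsHardSphereEulerSolution σ T ρ u θ → ∀ Φ : (N : ℕ) → HardSphereFlow (Torus.geometry (Fin 3)) (hsDiameter σ N) (N + 1), TendstoHydroFieldsAt (fun N => localGibbsLaw σ a₀ u₀ θ₀ N (Φ N)) Φ ρ u θ 0 → ∀ t : ℝ, 0 < t → t < T → (∀ s ∈ Icc 0 t, ∀ x, 2 * ρ s x * σ ^ 3 < η₁) → ∀ (γ C : ℝ) (φ : ℕ → T3 → ℝ), 0 < γ → γ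 ≤ 1 / 15 → ((∀ N, Literature.Analysis.FunctionSpaces.Torus.IsSmooth (φ N)) ∧ (∀ N y, 0 ≤ φ N y) ∧ (∀ N, ∫ y, φ N y = 1) ∧ (∀ (N : ℕ) y, ((N : ℝ) + 1) ^ (-γ) ≤ Torus.euclidDist y 0 → φ N y = 0) ∧ (∀ (N : ℕ) y, φ N y ≤ C * ((N : ℝ) + 1) ^ (3 * γ)) ∧ (∀ (N : ℕ) y, ‖Literature.Analysis.FunctionSpaces.Torus.gradient (φ N) y‖ ≤ C * ((N : ℝ) + 1) ^ (4 * γ))) → ∃ A : ℝ, ∃ N₀ : ℕ, ∀ N : ℕ, N₀ ≤ N → ∀ s ∈ Icc 0 t, ∀ x : T3, (∫ z, φ N (((Φ N).flow s z 0).1 - x) * φ N (((Φ N).flow s z 1).1 - x) ∂(localGibbsLaw σ a₀ u₀ θ₀ N (Φ N))) - (∫ z, φ N (((Φ N).flow s z 0).1 - x) ∂(localGibbsLaw σ a₀ u₀ θ₀ N (Φ N))) * (∫ z, φ N (((Φ N).flow s z 1).1 - x) ∂(localGibbsLaw σ a₀ u₀ θ₀ N (Φ N))) ≤ A * ((N :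 ℝ) + 1) ^ (3 * γ - 1)) → (∀ (a₀ θ₀ : T3 → ℝ) (u₀ : T3 → V3), Continuous a₀ → Continuous θ₀ → Continuous u₀ → (∀ x, 0 < a₀ x) → (∀ x, 0 < θ₀ x) → ∃ σ₀ : ℝ, 0 < σ₀ ∧ ∃ η₁ : ℝ, 0 < η₁ ∧ ∀ σ : ℝ, 0 < σ → σ < σ₀ → ∀ (T : ℝ) (ρ θ : ℝ → T3 → ℝ) (u : ℝ → T3 → V3), IsHardSphereEulerSolution σ T ρ u θ → ∀ Φ : (N : ℕ) → HardSphereFlow (Torus.geometry (Fin 3)) (hsDiameter σ N) (N + 1), TendstoHydroFieldsAt (fun N => localGibbsLaw σ a₀ u₀ θ₀ N (Φ N)) Φ ρ u θ 0 → ∀ t : ℝ, 0 < t → t < T → (∀ s ∈ Icc 0 t, ∀ x, 2 * ρ s x * σ ^ 3 < η₁) → FarTailAllAt σ a₀ θ₀ u₀ Φ t) → (∀ (a₀ θ₀ : T3 → ℝ) (u₀ : T3 → V3), Continuous a₀ → Continuous θ₀ → Continuous u₀ → (∀ x, 0 < a₀ x) → (∀ x, 0 < θ₀ x) → ∃ σ₀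 : ℝ, 0 < σ₀ ∧ ∃ η₁ : ℝ, 0 < η₁ ∧ ∀ σ : ℝ, 0 < σ → σ < σ₀ → ∀ (T : ℝ) (ρ θ : ℝ → T3 → ℝ) (u : ℝ → T3 → V3), IsHardSphereEulerSolution σ T ρ u θ → ∀ Φ : (N : ℕ) → HardSphereFlow (Torus.geometry (Fin 3)) (hsDiameter σ N) (N + 1), TendstoHydroFieldsAt (fun N => localGibbsLaw σ a₀ u₀ θ₀ N (Φ N)) Φ ρ u θ 0 → ∀ t : ℝ, 0 < t → t < T → (∀ s ∈ Icc 0 t, ∀ x, 2 * ρ s x * σ ^ 3 < η₁) → ∀ K : ℝ, Tendsto (fun N : ℕ => (∫ z, (∫⁻ s in Icc 0 t, ENNReal.ofReal (if K ≤ ‖((Φ N).flow s z 0).2‖ ^ 2 then (1 : ℝ) else 0)).toReal * (∫⁻ s in Icc 0 t, ENNReal.ofReal (if K ≤ ‖((Φ N).flow s z 1).2‖ ^ 2 then (1 : ℝ) else 0)).toReal ∂(localGibbsLaw σ a₀ u₀ θ₀ N (Φ N))) - (∫ z, (∫⁻ s in Icc 0 t, ENNReal.ofReal (if K ≤ ‖((Φ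 N).flow s z 0).2‖ ^ 2 then (1 : ℝ) else 0)).toReal ∂(localGibbsLaw σ a₀ u₀ θ₀ N (Φ N))) * (∫ z, (∫⁻ s in Icc 0 t, ENNReal.ofReal (if K ≤ ‖((Φ N).flow s z 1).2‖ ^ 2 then (1 : ℝ) else 0)).toReal ∂(localGibbsLaw σ a₀ u₀ θ₀ N (Φ N)))) atTop (𝓝 0)) → Summit.AtomisticToContinuum.HydrodynamicLimit.Theses.StiffCollisionalRelaxation.AprioriBounds :=
  fun h1 h2 h3 h5 h6 =>
  AprioriBounds_of_meso_stubs h1 h2 (mesoVariance_of_meanCeiling_pairCorrelation h2 h3) h5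
    (occupationVariance_of_pairDecorrelation h6)

/-- The same for the `CollisionIsometryCLT` copy of the crux (`AprioriBoundsPreShock`, one `Prop` with `StiffCollisionalRelaxation.AprioriBounds` by `Iff.rfl`). -/
theorem AprioriBoundsPreShock_of_r3_stubs : (∀ (a₀ θ₀ : T3 → ℝ) (u₀ : T3 → V3), Continuous a₀ → Continuous θ₀ → Continuous u₀ → (∀ x, 0 < a₀ x) → (∀ x, 0 < θ₀ x) → ∃ σ₀ : ℝ, 0 < σ₀ ∧ ∃ η₁ : ℝ, 0 < η₁ ∧ ∀ σ : ℝ, 0 < σ → σ < σ₀ → ∀ (T : ℝ) (ρ θ : ℝ → T3 → ℝ) (u : ℝ → T3 → V3), IsHardSphereEulerSolution σ T ρ u θ → ∀ Φ : (N : ℕ) → HardSphereFlow (Torus.geometry (Fin 3)) (hsDiameter σ N) (N + 1), TendstoHydroFieldsAt (fun N => localGibbsLaw σ a₀ u₀ θ₀ N (Φ N)) Φ ρ u θ 0 → ∀ t : ℝ, 0 < t → t < T → (∀ s ∈ Icc 0 t, ∀ x, 2 * ρ s x * σ ^ 3 < η₁) → ∀ (γ C : ℝ) (φ : ℕ → T3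 → ℝ), 0 < γ → γ ≤ 1 / 15 → ((∀ N, Literature.Analysis.FunctionSpaces.Torus.IsSmooth (φ N)) ∧ (∀ N y, 0 ≤ φ N y) ∧ (∀ N, ∫ y, φ N y = 1) ∧ (∀ (N : ℕ) y, ((N : ℝ) + 1) ^ (-γ) ≤ Torus.euclidDist y 0 → φ N y = 0) ∧ (∀ (N : ℕ) y, φ N y ≤ C * ((N : ℝ) + 1) ^ (3 * γ)) ∧ (∀ (N : ℕ) y, ‖Literature.Analysis.FunctionSpaces.Torus.gradient (φ N) y‖ ≤ C * ((N : ℝ) + 1) ^ (4 * γ))) → ∃ m : ℝ, 0 < m ∧ ∃ N₀ : ℕ, ∀ N : ℕ, N₀ ≤ N → ∀ s ∈ Icc 0 t, ∀ x : T3, m ≤ ∫ z, empiricalDensityField ((Φ N).flow s z) (fun y => φ N (y - x)) ∂(localGibbsLaw σ a₀ u₀ θ₀ N (Φ N))) → (∀ (a₀ θ₀ : T3 → ℝ) (u₀ : T3 → V3), Continuous a₀ → Continuous θ₀ → Continuous u₀ → (∀ x, 0 < a₀ x) → (∀ x, 0 < θ₀ x) → ∃ σ₀ : ℝ, 0 <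 σ₀ ∧ ∃ η₁ : ℝ, 0 < η₁ ∧ ∀ σ : ℝ, 0 < σ → σ < σ₀ → ∀ (T : ℝ) (ρ θ : ℝ → T3 → ℝ) (u : ℝ → T3 → V3), IsHardSphereEulerSolution σ T ρ u θ → ∀ Φ : (N : ℕ) → HardSphereFlow (Torus.geometry (Fin 3)) (hsDiameter σ N) (N + 1), TendstoHydroFieldsAt (fun N => localGibbsLaw σ a₀ u₀ θ₀ N (Φ N)) Φ ρ u θ 0 → ∀ t : ℝ, 0 < t → t < T → (∀ s ∈ Icc 0 t, ∀ x, 2 * ρ s x * σ ^ 3 < η₁) → ∀ (γ C : ℝ) (φ : ℕ → T3 → ℝ), 0 < γ → γ ≤ 1 / 15 → ((∀ N, Literature.Analysis.FunctionSpaces.Torus.IsSmooth (φ N)) ∧ (∀ N y, 0 ≤ φ N y) ∧ (∀ N, ∫ y, φ N y = 1) ∧ (∀ (N : ℕ) y, ((N : ℝ) + 1) ^ (-γ) ≤ Torus.euclidDist y 0 → φ N y = 0) ∧ (∀ (N : ℕ) y, φ N y ≤ C * ((N : ℝ) + 1) ^ (3 * γ)) ∧ (∀ (N : ℕ) y, ‖Literature.Analysis.FunctionSpaces.Torus.gradient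 (φ N) y‖ ≤ C * ((N : ℝ) + 1) ^ (4 * γ))) → ∃ κ : ℝ, κ < 1 ∧ ∃ N₀ : ℕ, ∀ N : ℕ, N₀ ≤ N → ∀ s ∈ Icc 0 t, ∀ x : T3, (∫ z, empiricalDensityField ((Φ N).flow s z) (fun y => φ N (y - x)) ∂(localGibbsLaw σ a₀ u₀ θ₀ N (Φ N))) * σ ^ 3 ≤ κ) → (∀ (a₀ θ₀ : T3 → ℝ) (u₀ : T3 → V3), Continuous a₀ → Continuous θ₀ → Continuous u₀ → (∀ x, 0 < a₀ x) → (∀ x, 0 < θ₀ x) → ∃ σ₀ : ℝ, 0 < σ₀ ∧ ∃ η₁ : ℝ, 0 < η₁ ∧ ∀ σ : ℝ, 0 < σ → σ < σ₀ → ∀ (T : ℝ) (ρ θ : ℝ → T3 → ℝ) (u : ℝ → T3 → V3), IsHardSphereEulerSolution σ T ρ u θ → ∀ Φ : (N : ℕ) → HardSphereFlow (Torus.geometry (Fin 3)) (hsDiameter σ N) (N + 1), TendstoHydroFieldsAt (fun N => localGibbsLaw σ a₀ u₀ θ₀ N (Φ N)) Φ ρ u θ 0 → ∀ t : ℝ,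 0 < t → t < T → (∀ s ∈ Icc 0 t, ∀ x, 2 * ρ s x * σ ^ 3 < η₁) → ∀ (γ C : ℝ) (φ : ℕ → T3 → ℝ), 0 < γ → γ ≤ 1 / 15 → ((∀ N, Literature.Analysis.FunctionSpaces.Torus.IsSmooth (φ N)) ∧ (∀ N y, 0 ≤ φ N y) ∧ (∀ N, ∫ y, φ N y = 1) ∧ (∀ (N : ℕ) y, ((N : ℝ) + 1) ^ (-γ) ≤ Torus.euclidDist y 0 → φ N y = 0) ∧ (∀ (N : ℕ) y, φ N y ≤ C * ((N : ℝ) + 1) ^ (3 * γ)) ∧ (∀ (N : ℕ) y, ‖Literature.Analysis.FunctionSpaces.Torus.gradient (φ N) y‖ ≤ C * ((N : ℝ) + 1) ^ (4 * γ))) → ∃ A : ℝ, ∃ N₀ : ℕ, ∀ N : ℕ, N₀ ≤ N → ∀ s ∈ Icc 0 t, ∀ x : T3, (∫ z, φ N (((Φ N).flow s z 0).1 - x) * φ N (((Φ N).flow s z 1).1 - x) ∂(localGibbsLaw σ a₀ u₀ θ₀ N (Φ N))) - (∫ z, φ N (((Φ N).flow s z 0).1 - x) ∂(localGibbsLaw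 σ a₀ u₀ θ₀ N (Φ N))) * (∫ z, φ N (((Φ N).flow s z 1).1 - x) ∂(localGibbsLaw σ a₀ u₀ θ₀ N (Φ N))) ≤ A * ((N : ℝ) + 1) ^ (3 * γ - 1)) → (∀ (a₀ θ₀ : T3 → ℝ) (u₀ : T3 → V3), Continuous a₀ → Continuous θ₀ → Continuous u₀ → (∀ x, 0 < a₀ x) → (∀ x, 0 < θ₀ x) → ∃ σ₀ : ℝ, 0 < σ₀ ∧ ∃ η₁ : ℝ, 0 < η₁ ∧ ∀ σ : ℝ, 0 < σ → σ < σ₀ → ∀ (T : ℝ) (ρ θ : ℝ → T3 → ℝ) (u : ℝ → T3 → V3), IsHardSphereEulerSolution σ T ρ u θ → ∀ Φ : (N : ℕ) → HardSphereFlow (Torus.geometry (Fin 3)) (hsDiameter σ N) (N + 1), TendstoHydroFieldsAt (fun N => localGibbsLaw σ a₀ u₀ θ₀ N (Φ N)) Φ ρ u θ 0 → ∀ t : ℝ, 0 < t → t < T → (∀ s ∈ Icc 0 t, ∀ x, 2 * ρ s x * σ ^ 3 < η₁) → FarTailAllAt σ a₀ θ₀ u₀ Φ t) → (∀ (a₀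 θ₀ : T3 → ℝ) (u₀ : T3 → V3), Continuous a₀ → Continuous θ₀ → Continuous u₀ → (∀ x, 0 < a₀ x) → (∀ x, 0 < θ₀ x) → ∃ σ₀ : ℝ, 0 < σ₀ ∧ ∃ η₁ : ℝ, 0 < η₁ ∧ ∀ σ : ℝ, 0 < σ → σ < σ₀ → ∀ (T : ℝ) (ρ θ : ℝ → T3 → ℝ) (u : ℝ → T3 → V3), IsHardSphereEulerSolution σ T ρ u θ → ∀ Φ : (N : ℕ) → HardSphereFlow (Torus.geometry (Fin 3)) (hsDiameter σ N) (N + 1), TendstoHydroFieldsAt (fun N => localGibbsLaw σ a₀ u₀ θ₀ N (Φ N)) Φ ρ u θ 0 → ∀ t : ℝ, 0 < t → t < T → (∀ s ∈ Icc 0 t, ∀ x, 2 * ρ s x * σ ^ 3 < η₁) → ∀ K : ℝ, Tendsto (fun N : ℕ => (∫ z, (∫⁻ s in Icc 0 t, ENNReal.ofReal (if K ≤ ‖((Φ N).flow s z 0).2‖ ^ 2 then (1 : ℝ) else 0)).toReal * (∫⁻ s in Icc 0 t, ENNReal.ofReal (if K ≤ ‖((Φ N).flow s z 1).2‖ ^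 2 then (1 : ℝ) else 0)).toReal ∂(localGibbsLaw σ a₀ u₀ θ₀ N (Φ N))) - (∫ z, (∫⁻ s in Icc 0 t, ENNReal.ofReal (if K ≤ ‖((Φ N).flow s z 0).2‖ ^ 2 then (1 : ℝ) else 0)).toReal ∂(localGibbsLaw σ a₀ u₀ θ₀ N (Φ N))) * (∫ z, (∫⁻ s in Icc 0 t, ENNReal.ofReal (if K ≤ ‖((Φ N).flow s z 1).2‖ ^ 2 then (1 : ℝ) else 0)).toReal ∂(localGibbsLaw σ a₀ u₀ θ₀ N (Φ N)))) atTop (𝓝 0)) → Summit.AtomisticToContinuum.HydrodynamicLimit.Theses.CollisionIsometryCLT.AprioriBoundsPreShock :=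
  fun h1 h2 h3 h5 h6 =>
  AprioriBounds_of_r3_stubs h1 h2 h3 h5 h6

/-- **The minimal-import capstone, r3 form: `AprioriBounds ⇐ KineticRangeControl (stmt-9201) ∧ GaussianTails (stmt-14415) ∧ PairDecorrelation (r3-stub 6 text)`** — the D3 split of `Cruxes/AprioriBounds/D3-SPLIT.md` with its ONE new child typed at BBGKY level two (decorrelation of two tagged spheres' time-averaged tail sojourns), equivalent under the prefix to the variance child `OccupationVariance` (`occupationVariance_of_pairDecorrelation` / `pairDecorrelation_of_occupationVariance`); via `AprioriBounds_of_KRC_GT_occupationVariance` (p147849). -/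
theorem AprioriBounds_of_KRC_GT_pairDecorrelation : Summit.AtomisticToContinuum.HydrodynamicLimit.Theses.GermanoSplitLES.KineticRangeControl → Summit.AtomisticToContinuum.HydrodynamicLimit.Theses.UGibbsSRBRigidity.GaussianTails → (∀ (a₀ θ₀ : T3 → ℝ) (u₀ : T3 → V3), Continuous a₀ → Continuous θ₀ → Continuous u₀ → (∀ x, 0 < a₀ x) → (∀ x, 0 < θ₀ x) → ∃ σ₀ : ℝ, 0 < σ₀ ∧ ∃ η₁ : ℝ, 0 < η₁ ∧ ∀ σ : ℝ, 0 < σ → σ < σ₀ → ∀ (T : ℝ) (ρ θ : ℝ → T3 → ℝ) (u : ℝ → T3 → V3), IsHardSphereEulerSolution σ T ρ u θ → ∀ Φ : (N : ℕ) → HardSphereFlow (Torus.geometry (Fin 3)) (hsDiameter σ N) (N + 1), TendstoHydroFieldsAt (fun N => localGibbsLaw σ a₀ u₀ θ₀ N (Φ N)) Φ ρ u θ 0 → ∀ t : ℝ, 0 < t → t < T → (∀ s ∈ Icc 0 t, ∀ x, 2 * ρ s x * σ ^ 3 < η₁) → ∀ K : ℝ, Tendsto (fun N : ℕ => (∫ z,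 (∫⁻ s in Icc 0 t, ENNReal.ofReal (if K ≤ ‖((Φ N).flow s z 0).2‖ ^ 2 then (1 : ℝ) else 0)).toReal * (∫⁻ s in Icc 0 t, ENNReal.ofReal (if K ≤ ‖((Φ N).flow s z 1).2‖ ^ 2 then (1 : ℝ) else 0)).toReal ∂(localGibbsLaw σ a₀ u₀ θ₀ N (Φ N))) - (∫ z, (∫⁻ s in Icc 0 t, ENNReal.ofReal (if K ≤ ‖((Φ N).flow s z 0).2‖ ^ 2 then (1 : ℝ) else 0)).toReal ∂(localGibbsLaw σ a₀ u₀ θ₀ N (Φ N))) * (∫ z, (∫⁻ s in Icc 0 t, ENNReal.ofReal (if K ≤ ‖((Φ N).flow s z 1).2‖ ^ 2 then (1 : ℝ) else 0)).toReal ∂(localGibbsLaw σ a₀ u₀ θ₀ N (Φ N)))) atTop (𝓝 0)) → Summit.AtomisticToContinuum.HydrodynamicLimit.Theses.StiffCollisionalRelaxation.AprioriBounds :=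
  fun hKRC hGT h6 =>
  AprioriBounds_of_KRC_GT_occupationVariance hKRC hGT (occupationVariance_of_pairDecorrelation h6)

/-- **`AprioriBounds ⇐ KineticRangeControl (stmt-9201) ∧ GaussianTails (stmt-14415) ∧ FixedTimeTailVariance`** — the third child in its ONE-BODY, FIXED-TIME, IDENTIFICATION-FREE form: under the crux prefix, for every level `K` and every fixed `s ∈ [0,t]`, `Var_{P_N}(frac_K ∘ Φ^N_s) → 0` (self-averaging of the one-particle tail fraction at fixed Euler times; no limit named, no Euler field, no rate).  It implies the variance child by Cauchy–Schwarz in time (`occupationVariance_of_fixedTimeTailVariance`, p168597, pure measure theory) — so the (i)-residue of the crux is AT MOST fixed-time one-body concentration of bounded velocity statistics (strictly weaker than any one-body LLN that identifies its limit, e.g. `AnosovDiceHopf.MaxwellianOneBodyInBand` stmt-17603, see `AprioriBounds_of_KRC_GT_maxwellianOneBodyInBand`); via p147849. -/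
theorem AprioriBounds_of_KRC_GT_fixedTimeTailVariance : Summit.AtomisticToContinuum.HydrodynamicLimit.Theses.GermanoSplitLES.KineticRangeControl → Summit.AtomisticToContinuum.HydrodynamicLimit.Theses.UGibbsSRBRigidity.GaussianTails → (∀ (a₀ θ₀ : T3 → ℝ) (u₀ : T3 → V3), Continuous a₀ → Continuous θ₀ → Continuous u₀ → (∀ x, 0 < a₀ x) → (∀ x, 0 < θ₀ x) → ∃ σ₀ : ℝ, 0 < σ₀ ∧ ∃ η₁ : ℝ, 0 < η₁ ∧ ∀ σ : ℝ, 0 < σ → σ < σ₀ → ∀ (T : ℝ) (ρ θ : ℝ → T3 → ℝ) (u : ℝ → T3 → V3), IsHardSphereEulerSolution σ T ρ u θ → ∀ Φ : (N : ℕ) → HardSphereFlow (Torus.geometry (Fin 3)) (hsDiameter σ N) (N + 1), TendstoHydroFieldsAt (fun N => localGibbsLaw σ a₀ u₀ θ₀ N (Φ N)) Φ ρ u θ 0 → ∀ t : ℝ, 0 < t → t < T → (∀ s ∈ Icc 0 t, ∀ x, 2 * ρ s x * σ ^ 3 < η₁) → ∀ K : ℝ, ∀ s ∈ Icc 0 t,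 Tendsto (fun N : ℕ => variance (fun z => frac K ((Φ N).flow s z)) (localGibbsLaw σ a₀ u₀ θ₀ N (Φ N))) atTop (𝓝 0)) → Summit.AtomisticToContinuum.HydrodynamicLimit.Theses.StiffCollisionalRelaxation.AprioriBounds :=
  fun hKRC hGT hF =>
  AprioriBounds_of_KRC_GT_occupationVariance hKRC hGT (occupationVariance_of_fixedTimeTailVariance hF)

/-- **`AprioriBounds ⇐ KineticRangeControl (stmt-9201) ∧ GaussianTails (stmt-14415) ∧ MaxwellianOneBodyInBand (stmt-17603)` — the crux from THREE EXISTING ITEMS, kernel-checked.**  The live one-body local-Maxwellian LLN at fixed Euler times in the packing band (route `AnosovDiceHopf`, item stmt-AtomisticToContinuum-17603, OPEN) gives fixed-time tail-fraction variances `→ 0` (`fixedTimeTailVariance_of_maxwellianOneBodyInBand`, p168989: continuous sandwich of `𝟙{K ≤ |v|²}`, shell mass `→ 0`), hence the variance child (`occupationVariance_of_maxwellianOneBodyInBand`), hence the crux via p147849.  CAVEAT FOR PLANNERS (strength, not validity): 17603 IDENTIFIES the one-body limit as the local Maxwellian of the Euler solution — it is local-equilibrium strength (its docstring: `not implied by HydrodynamicLimit`),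 far more than the identification-free concentration the crux consumes (`AprioriBounds_of_KRC_GT_fixedTimeTailVariance`); as a D3 child it is an existing, refuter-stamped, staffable item, but a route that derives `HydrodynamicLimit` FROM `AprioriBounds` must not also plan to obtain 17603 from that limit (cf. the death of line `fibre-deficit-transfer` at a conjunct-strength input). -/
theorem AprioriBounds_of_KRC_GT_maxwellianOneBodyInBand : Summit.AtomisticToContinuum.HydrodynamicLimit.Theses.GermanoSplitLES.KineticRangeControl → Summit.AtomisticToContinuum.HydrodynamicLimit.Theses.UGibbsSRBRigidity.GaussianTails → Summit.AtomisticToContinuum.HydrodynamicLimit.Theses.AnosovDiceHopf.MaxwellianOneBodyInBand → Summit.AtomisticToContinuum.HydrodynamicLimit.Theses.StiffCollisionalRelaxation.AprioriBounds :=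
  fun hKRC hGT hM =>
  AprioriBounds_of_KRC_GT_occupationVariance hKRC hGT (occupationVariance_of_maxwellianOneBodyInBand hM)

/-- The same three-existing-items capstone for the `CollisionIsometryCLT` copy of the crux (`AprioriBoundsPreShock`, stmt-AtomisticToContinuum-14827 as keyed in that route). -/
theorem AprioriBoundsPreShock_of_KRC_GT_maxwellianOneBodyInBand : Summit.AtomisticToContinuum.HydrodynamicLimit.Theses.GermanoSplitLES.KineticRangeControl → Summit.AtomisticToContinuum.HydrodynamicLimit.Theses.UGibbsSRBRigidity.GaussianTails → Summit.AtomisticToContinuum.HydrodynamicLimit.Theses.AnosovDiceHopf.MaxwellianOneBodyInBand → Summit.AtomisticToContinuum.HydrodynamicLimit.Theses.CollisionIsometryCLT.AprioriBoundsPreShock :=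
  fun hKRC hGT hM =>
  AprioriBounds_of_KRC_GT_maxwellianOneBodyInBand hKRC hGT hM

end Summit.AtomisticToContinuum.HydrodynamicLimit.Theorems.MesoChebyshevWindow

end
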